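import Summits.Parity.BatemanHorn.Theorems.SoloInformedSquareSieve
import Literature.NumberTheory.Sieve.SmoothNumbersLowerBoundLHalf
import Literature.NumberTheory.Sieve.ShiftedPrimeDivisors
import Mathlib.RingTheory.Polynomial.UniqueFactorization
import Mathlib.Algebra.Polynomial.Degree.SmallDegree

/-!
# SoloInformedQuadraticSquares — square values of a quadratic polynomial are `o(x / log x)`

Solo unit `solo-Parity-informed` (ideation tier, informed mode), session 12; `PLAN.md` §19.3(a), CLAIMS C52.

For `g = aX² + bX + c ∈ ℤ[X]` with `a ≠ 0` and `b² - 4ac ≠ 0` (automatic for an irreducible quadratic,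
`discr_ne_zero_of_irreducible`), and every `δ > 0`:

  `#{1 ≤ n ≤ x : g(n) is a perfect square} · log x ≤ δ x`  for all large `x`

(`eventually_card_isSquare_eval_mul_log_le`). Proof: the square sieve of `SoloInformedSquareSieve` with the
primes `7 ≤ q ≤ z = ⌊log x / 2⌋` not dividing `a (b² - 4ac)` (product `≤ 4^z ≤ x`, at least
`z/(4 log z) - O(1)` of them by the Chebyshev bound `div_four_mul_log_le_primeCounting`), each removing a
fraction `≥ 2/7` of the residues; `(5/7)^{#S} ≤ exp(-#S/3) ≤ δ/(2 log x)`.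
-/

namespace Summit.Parity.BatemanHorn.Theorems

open Finset Filter Polynomial
open scoped Topology

/-! ### Irreducible quadratics have non-zero discriminant -/

/-- A polynomial of degree `≤ 2` is `g₂ X² + g₁ X + g₀`. -/
theorem eq_quadratic_of_natDegree_le_two (g : ℤ[X]) (hdeg : g.natDegree ≤ 2) :
    g = C (g.coeff 2) * X ^ 2 + C (g.coeff 1) * X + C (g.coeff 0) := by
  conv_lhs => rw [g.as_sum_range_C_mul_X_pow' (show g.natDegree < 3 by omega)]
  simp only [sum_range_succ, sum_range_zero, zero_add, pow_zero, mul_one, pow_one]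
  ring

/-- An irreducible `g ∈ ℤ[X]` of degree `2` has `g₁² - 4 g₂ g₀ ≠ 0`
(else `4 g₂ · g = (2 g₂ X + g₁)²`, and the prime `g` would divide a linear polynomial). -/
theorem discr_ne_zero_of_irreducible {g : ℤ[X]} (hirr : Irreducible g) (hdeg : g.natDegree = 2) :
    g.coeff 1 ^ 2 - 4 * g.coeff 2 * g.coeff 0 ≠ 0 := by
  obtain ⟨a, b, c, hg⟩ : ∃ a b c : ℤ, g = C a * X ^ 2 + C b * X + C c :=
    ⟨_, _, _, eq_quadratic_of_natDegree_le_two g hdeg.le⟩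
  have h2 : g.coeff 2 = a := by
    rw [hg]; simp only [coeff_add, coeff_C_mul_X_pow, coeff_C_mul_X, coeff_C]; simp
  have h1 : g.coeff 1 = b := by
    rw [hg]; simp only [coeff_add, coeff_C_mul_X_pow, coeff_C_mul_X, coeff_C]; simp
  have h0 : g.coeff 0 = c := by
    rw [hg]; simp only [coeff_add, coeff_C_mul_X_pow, coeff_C_mul_X, coeff_C]; simp
  have ha : a ≠ 0 := by
    rw [← h2, ← hdeg, coeff_natDegree]
    exact leadingCoeff_ne_zero.mpr hirr.ne_zero
  rw [h2, h1, h0]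
  intro hD
  have key : (C (2 * a) * X + C b) ^ 2 = C (4 * a) * g := by
    rw [hg]
    have e : C b ^ 2 = 4 * C a * C c := by
      rw [← C_pow, ← map_ofNat C 4, ← C_mul, ← C_mul]
      exact congrArg C (by linear_combination hD)
    simp only [C_mul, map_ofNat]
    linear_combination e
  have hlin0 : C (2 * a) * X + C b ≠ 0 := by
    intro h0
    have h := congrArg natDegree h0
    rw [natDegree_linear (mul_ne_zero two_ne_zero ha), natDegree_zero] at h
    exact one_ne_zero h
  have hdvd : g ∣ (C (2 * a) * X + C b) ^ 2 := ⟨C (4 * a), by rw [key, mul_comm]⟩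
  have hprime : Prime g := UniqueFactorizationMonoid.irreducible_iff_prime.mp hirr
  have hle := natDegree_le_of_dvd (hprime.dvd_of_dvd_pow hdvd) hlin0
  rw [natDegree_linear (mul_ne_zero two_ne_zero ha), hdeg] at hle
  omega

/-! ### Good primes -/

/-- A prime `q ∤ M` does not divide any integer `x` with `|x| ∣ M`. -/
theorem intCast_zmod_ne_zero_of_not_dvd {q M : ℕ} {x : ℤ} (hx : x.natAbs ∣ M) (hq : ¬q ∣ M) :
    (x : ZMod q) ≠ 0 := by
  intro h
  rw [ZMod.intCast_zmod_eq_zero_iff_dvd] at h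
  exact hq ((Int.natCast_dvd.mp h).trans hx)

/-- The square sieve with the good primes `7 ≤ q ≤ z`, `q ∤ M` (`M` a common multiple of `|g₂|` and
`|g₁² - 4 g₂ g₀|`): `#{1 ≤ n ≤ N : g(n) square} ≤ (5/7)^{#S_z} (N + 4^z)`. -/
theorem card_isSquare_eval_le_of_goodPrimes (g : ℤ[X]) (hdeg : g.natDegree ≤ 2) {M : ℕ}
    (hMa : (g.coeff 2).natAbs ∣ M) (hMD : (g.coeff 1 ^ 2 - 4 * g.coeff 2 * g.coeff 0).natAbs ∣ M)
    (z N : ℕ) :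
    (#((Icc 1 N).filter fun n : ℕ => IsSquare (g.eval (n : ℤ))) : ℝ)
      ≤ (5 / 7 : ℝ) ^ #((range (z + 1)).filter fun q : ℕ => q.Prime ∧ 7 ≤ q ∧ ¬q ∣ M)
        * (N + 4 ^ z) := by
  set S := (range (z + 1)).filter fun q : ℕ => q.Prime ∧ 7 ≤ q ∧ ¬q ∣ M with hSdef
  have hS : ∀ q ∈ S, q.Prime ∧ 7 ≤ q ∧ ((g.coeff 2 : ℤ) : ZMod q) ≠ 0 ∧
      ((g.coeff 1 ^ 2 - 4 * g.coeff 2 * g.coeff 0 : ℤ) : ZMod q) ≠ 0 := by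
    intro q hq
    obtain ⟨_, hqp, hq7, hqM⟩ := mem_filter.mp hq
    exact ⟨hqp, hq7, intCast_zmod_ne_zero_of_not_dvd hMa hqM, intCast_zmod_ne_zero_of_not_dvd hMD hqM⟩
  have hprod : ∏ q ∈ S, (q : ℝ) ≤ 4 ^ z := by
    have h : ((∏ q ∈ S, q : ℕ) : ℝ) ≤ ((4 ^ z : ℕ) : ℝ) := Nat.cast_le.mpr (prod_goodPrimes_le_four_pow M z)
    rw [Nat.cast_prod, Nat.cast_pow, Nat.cast_ofNat] at h
    exact h
  calc (#((Icc 1 N).filter fun n : ℕ => IsSquare (g.eval (n : ℤ))) : ℝ)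
      ≤ (5 / 7 : ℝ) ^ #S * (N + ∏ q ∈ S, (q : ℝ)) := card_Icc_filter_eval_eq_sq_le g hdeg S hS N
    _ ≤ (5 / 7 : ℝ) ^ #S * (N + 4 ^ z) := by gcongr

/-- There are at least `z/(4 log z) - 3 - ω(M)` good primes up to `z ≥ 4`. -/
theorem sub_le_card_goodPrimes {M : ℕ} (hM0 : M ≠ 0) {z : ℕ} (hz : 4 ≤ z) :
    (z : ℝ) / (4 * Real.log z) - (3 + #M.primeFactors)
      ≤ #((range (z + 1)).filter fun q : ℕ => q.Prime ∧ 7 ≤ q ∧ ¬q ∣ M) := by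
  have h1 := Literature.NumberTheory.Sieve.div_four_mul_log_le_primeCounting hz
  have h2 : (Nat.primeCounting z : ℝ)
      ≤ #((range (z + 1)).filter fun q : ℕ => q.Prime ∧ 7 ≤ q ∧ ¬q ∣ M) + 3 + #M.primeFactors := by
    exact_mod_cast primeCounting_le_card_goodPrimes_add hM0 z
  linarith

/-- `5/7 ≤ e^{-1/3}`, i.e. `e ≤ (7/5)³ = 2.744`. -/
theorem five_div_seven_le_exp_neg_third : (5 / 7 : ℝ) ≤ Real.exp (-(1 / 3)) := by
  rw [Real.exp_neg, le_inv_comm₀ (by norm_num) (Real.exp_pos _), show (5 / 7 : ℝ)⁻¹ = 7 / 5 by norm_num]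
  have h : Real.exp (1 / 3) ^ 3 ≤ (7 / 5 : ℝ) ^ 3 := by
    rw [← Real.exp_nat_mul]
    have he := Real.exp_one_lt_d9
    norm_num at he ⊢
    exact he.le.trans (by norm_num)
  exact (pow_le_pow_iff_left₀ (Real.exp_pos _).le (by norm_num) (by norm_num)).mp h

/-! ### The count of square values -/

/-- **Square values of a quadratic are `o(x / log x)`.** For `g ∈ ℤ[X]` of degree `≤ 2` with `g₂ ≠ 0`
and `g₁² - 4 g₂ g₀ ≠ 0`, and every `δ > 0`: eventually `#{1 ≤ n ≤ x : g(n) is a square} · log x ≤ δ x`. -/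
theorem eventually_card_isSquare_eval_mul_log_le (g : ℤ[X]) (hdeg : g.natDegree ≤ 2)
    (ha : g.coeff 2 ≠ 0) (hD : g.coeff 1 ^ 2 - 4 * g.coeff 2 * g.coeff 0 ≠ 0) {δ : ℝ} (hδ : 0 < δ) :
    ∀ᶠ x : ℕ in atTop,
      (#((Icc 1 x).filter fun n : ℕ => IsSquare (g.eval (n : ℤ))) : ℝ) * Real.log x ≤ δ * x := by
  set M := (g.coeff 2 * (g.coeff 1 ^ 2 - 4 * g.coeff 2 * g.coeff 0)).natAbs with hM
  have hM0 : M ≠ 0 := Int.natAbs_ne_zero.mpr (mul_ne_zero ha hD)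
  have hMa : (g.coeff 2).natAbs ∣ M := by
    rw [hM, Int.natAbs_mul]
    exact dvd_mul_right _ _
  have hMD : (g.coeff 1 ^ 2 - 4 * g.coeff 2 * g.coeff 0).natAbs ∣ M := by
    rw [hM, Int.natAbs_mul]
    exact dvd_mul_left _ _
  set K : ℝ := 3 + #M.primeFactors with hK
  have hev := Literature.NumberTheory.Sieve.ShiftedPrimeDivisors.eventually_add_log_le_mul_div_log
    (show (0 : ℝ) < 1 / 24 by norm_num) ((K + 1 / 4 + 3 * Real.log (2 / δ)) / 3)
  have hlog : Tendsto (fun x : ℕ => Real.log x) atTop atTop :=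
    Real.tendsto_log_atTop.comp tendsto_natCast_atTop_atTop
  have he := Real.exp_one_lt_d9
  norm_num at he
  filter_upwards [hlog.eventually hev, hlog.eventually (eventually_ge_atTop 10), eventually_ge_atTop 1]
    with x hx hL10 hx1
  set L := Real.log x with hLdef
  set z := ⌊L / 2⌋₊ with hz
  set S := (range (z + 1)).filter (fun q : ℕ => q.Prime ∧ 7 ≤ q ∧ ¬q ∣ M) with hSdef
  have hL0 : 0 < L := by linarith
  have hL0' : 0 ≤ L := hL0.le
  have hz4 : 4 ≤ z := Nat.le_floor (by push_cast; linarith)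
  have hzL : (z : ℝ) ≤ L / 2 := Nat.floor_le (by linarith)
  have hzL' : L / 2 - 1 ≤ z := by
    have h := Nat.lt_floor_add_one (L / 2)
    rw [← hz] at h
    linarith
  have hx0 : (0 : ℝ) < x := by exact_mod_cast (show 0 < x by omega)
  -- `4^z ≤ x`
  have h4 : (4 : ℝ) ^ z ≤ x := by
    have h := Literature.NumberTheory.Sieve.ShiftedPrimeDivisors.four_pow_le_rpow (N := x) (w := z)
      (δ₁ := 1) (by omega) (by rw [one_mul, ← hLdef]; linarith)
    rw [Real.rpow_one] at h
    exact_mod_cast h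
  -- `#S ≥ 3 log L + 3 log (2/δ)`
  have hS1 : (z : ℝ) / (4 * Real.log z) - K ≤ #S := by
    rw [hK, hSdef]
    exact sub_le_card_goodPrimes hM0 hz4
  have hlogz : 0 < Real.log z := Real.log_pos (by exact_mod_cast (show 1 < z by omega))
  have hlogL1 : 1 ≤ Real.log L := by
    rw [Real.le_log_iff_exp_le (by linarith)]
    linarith
  have hlogzL : Real.log z ≤ Real.log L :=
    Real.log_le_log (by exact_mod_cast (show 0 < z by omega)) (by linarith)
  have hS2 : (L / 2 - 1) / (4 * Real.log L) ≤ (z : ℝ) / (4 * Real.log z) :=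
    (div_le_div_of_nonneg_right hzL' (by linarith)).trans
      (div_le_div_of_nonneg_left (Nat.cast_nonneg z) (by linarith) (by linarith))
  have hS3 : 3 * Real.log L + 3 * Real.log (2 / δ) ≤ #S := by
    have e1 : (L / 2 - 1) / (4 * Real.log L) = L / (8 * Real.log L) - 1 / (4 * Real.log L) := by
      field_simp
      ring
    have e2 : 1 / (4 * Real.log L) ≤ 1 / 4 :=
      div_le_div_of_nonneg_left zero_le_one (by norm_num) (by linarith)
    have e3 : (1 / 24 : ℝ) * L / Real.log L = (L / (8 * Real.log L)) / 3 := by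
      field_simp
      ring
    rw [e3] at hx
    linarith
  -- `(5/7)^{#S} ≤ δ / (2 L)`
  have h57 : (5 / 7 : ℝ) ^ #S ≤ δ / (2 * L) := by
    calc (5 / 7 : ℝ) ^ #S ≤ Real.exp (-(1 / 3)) ^ #S :=
          pow_le_pow_left₀ (by norm_num) five_div_seven_le_exp_neg_third _
      _ = Real.exp (-((#S : ℝ) / 3)) := by
          rw [← Real.exp_nat_mul]
          congr 1
          ring
      _ ≤ Real.exp (-(Real.log L + Real.log (2 / δ))) := Real.exp_le_exp.mpr (by linarith)
      _ = δ / (2 * L) := by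
          rw [Real.exp_neg, Real.exp_add, Real.exp_log hL0, Real.exp_log (by positivity)]
          field_simp
  -- assemble
  have hmain := card_isSquare_eval_le_of_goodPrimes g hdeg hMa hMD z x
  rw [← hSdef] at hmain
  calc (#((Icc 1 x).filter fun n : ℕ => IsSquare (g.eval (n : ℤ))) : ℝ) * L
      ≤ (5 / 7 : ℝ) ^ #S * (x + 4 ^ z) * L := by gcongr
    _ ≤ (5 / 7 : ℝ) ^ #S * (x + x) * L := by gcongr
    _ ≤ δ / (2 * L) * (x + x) * L := by gcongr
    _ = δ * x := by
        field_simp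
        ring

end Summit.Parity.BatemanHorn.Theorems
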